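/-
Copyright (c) 2026 the pub-hodgecm-mathlib formalisation cell (harness21).  Prover seat hodgecm-mathlib-LH4-p13 (g7), req620 Track A «(D-RAM) FOUR-FRAME» squad, tier 0,
STAGE-1b PRE-SCOPING (heir LEAD F0P3a-plan (g20) T19-24 «allowed as scoping»): organ (L-lab) «THE LABEL LAW» of the rows `stub_rows_transvPlus ∕ stub_rows_transvMinus`
— brick (L-lab-5) «THE SHARP σ-FIXED REPRESENTATIVE `F₀·a₀` OF THE ONE-SLOT SCALAR» (PRESCOPE (L-lab) v2 a4f3e5ee (Q1)): with `α = a∕σa`, `a = a₀ + a₁ϖ` in fixed coordinates,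
the one-slot scalar is `F₀·a` (`F₀ ∈ F`) and the window of ★ (L-lab-3) is EXACTLY `|F₀·a₁·ϖ·t₊| ≤ |ϖ|^{m*}`, i.e. `v(α − 1) ≥ 3d − 2` on the unit layer.  2026-09-04.
-/
import Summits.HodgeConjecture.HodgeConjecture.Theorems.F0P3cDyRamSmulXPlusLabel   -- ★ p858904 (this seat, (L-lab-3)): `labelPlus_smul_xPlus_iff_exists_norm_of_congr`; brings the chain
import HarnessLib

/-!
# Crux `H413`, line LH4 «(D-RAM) FOUR-FRAME», tier 0, STAGE-1b pre-scoping — (L-lab-5): the one-slot scalar in Hilbert-90 coordinates and its sharp σ-fixed representative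

Cell `hodgecm-mathlib` (D-0151), FLOOR 0, crux item H413 = `stmt-HodgeConjecture-24833`, route of record `HCCMUnconditional`; squad F0∕P3c∕LH4.  SCOPING INVENTORY (PLAN-T1
v19 (L-lab)); THEOREMS ONLY (no `def`, no instance, no notation, no `sorry`, default heartbeats), ★-only imports, lane `--supports stmt-HodgeConjecture-24833 --as helper`;
pays NO row, states NO law.

THE MATHEMATICS.  By Hilbert 90 for the involution (★ `WildQuadraticDatumNormOneQuotient.exists_unit_eq_div_map`, LH4-p09 (g2)) a deep norm-one `α` is `a∕σa` with `a` a UNIT,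
and `a = a₀ + a₁·ϖ` with `a₀, a₁` σ-FIXED (★ `exists_fixed_coords_of_map_ne`).  Then `α − 1 = (a − σa)∕σa = a₁·(ϖ − σϖ)∕σa`, so the one-slot scalar `e` of ★ (L-lab-1)∕(L-lab-2)
(`e·t₊ = (α − 1)·c`, `c = N(f b i)⁻¹·N(s⋆) ∈ F`, `t₊ = (ϖ − σϖ)·((ϖσϖ)^{⌊d∕2⌋})⁻¹`) is
  **`e = F₀·a`,  `F₀ := a₁·c·(ϖσϖ)^{⌊d∕2⌋}∕(a·σa) ∈ F`** (§1),
so `e′ := F₀·a₀` is σ-fixed with **`e − e′ = F₀·a₁·ϖ`** (§2): the scalar is EXACTLY as `F`-rational as the Hilbert-90 numerator, `|e − e′| = |e|·|a₁ϖ| = |e|·|α − 1|·|ϖ|^{1−d}`.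
Feeding `e′` to ★ (L-lab-3) `labelPlus_smul_xPlus_iff_exists_norm_of_congr` gives (§3) **`LabelPlus σ ϖ d m* (e • X₊) ↔ F₀·a₀ ∈ N(E^×)` under the SHARP window
`|(ϖ^{m*})⁻¹·(F₀·a₁·ϖ·t₊)| ≤ 1`** (on the unit layer `|e| = 1`: `v_E(a₁ϖ) ≥ m* − ℓ₀ = 2d − 1`, i.e. `v(α − 1) ≥ 3d − 2`) — and `ω(F₀·a₀) = ω(a₁·a₀·(ϖσϖ)^{⌊d∕2⌋})·ω(c)` carries the factor
`ω(N(f b i)) = κ_i(b)` through `c`.  Below the window, (Q1) of the PRESCOPE note: `e` is NOT congruent to any element of `F` at level `m*` (fixed elements have even valuation, `a₁ϖ`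
odd — ★ `v_ne_varpi_pow_odd_of_fixed`), so the label is `−` at every frame; the census tables decide whether such vertices lie on the shell.
* §1 `oneSlot_scalar_eq_mul` (`e = F₀·a`), `map_F₀` (`σF₀ = F₀`).  §2 `sub_sharpRep`, `map_sharpRep`.  §3 **`labelPlus_smul_xPlus_iff_exists_norm_sharpRep`**.
HONEST LABEL.  Count-neutral scoping brick; the three tier-0 rows stay OPEN; `HC_CM` is proved only modulo the 7 printed citations (2 remaining named inputs: hLiu418 =
`stmt-HodgeConjecture-24832`, h413 = `stmt-HodgeConjecture-24833`) until rung 0 closes.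

## References
* [Serre1979] J.-P. Serre, *Local Fields*, GTM 67 (1979), Ch. V §3 Cor. 3 (norm classes and the conductor of a ramified quadratic extension); Ch. X §1 (Hilbert 90).
* [Rogawski1990] J. D. Rogawski, *Automorphic Representations of Unitary Groups in Three Variables*, Ann. of Math. Stud. 123 (1990), §4.9 Prop. 4.9.1 (b) p. 55.
* [LanglandsShelstad1987] R. P. Langlands, D. Shelstad, *On the definition of transfer factors*, Math. Ann. 278 (1987), §3.
-/

set_option autoImplicit false

noncomputable section

namespace Summit.HodgeConjecture.HodgeConjecture.Cruxes.H413.F0P3cDyRamOneSlotScalarSharpRep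

open Literature.NumberTheory.Automorphic.UnitaryThreeFourFrame
open Summit.HodgeConjecture.HodgeConjecture.Cruxes.H413.F0P3cDyRamFourFramePieces
open Summit.HodgeConjecture.HodgeConjecture.Cruxes.H413.F0P3cDyRamSmulXPlusLabel (labelPlus_smul_xPlus_iff_exists_norm_of_congr)
open scoped Valued
open WithZero

variable {K : Type} [Field K]

/-! ## §1  The one-slot scalar in Hilbert-90 coordinates: `e = F₀·a` -/

/-- **`e = F₀·a`** with `F₀ = a₁·c·(ϖσϖ)^{⌊d∕2⌋}∕(a·σa)`: if `α = a∕σa`, `a = a₀ + a₁ϖ` with `σa₀ = a₀`, `σa₁ = a₁`, `a ≠ 0`, and `e·t₊ = (α − 1)·c`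
(`t₊ = (ϖ − σϖ)·((ϖσϖ)^{⌊d∕2⌋})⁻¹ ≠ 0`, `ϖ ≠ σϖ`). [cite: Serre1979, Ch. X §1] -/
theorem oneSlot_scalar_eq_mul {σ : K →+* K} {ϖ a a₀ a₁ α c e : K} {d : ℕ} (ha : a = a₀ + a₁ * ϖ) (ha₀ : σ a₀ = a₀) (ha₁ : σ a₁ = a₁)
    (ha0 : a ≠ 0) (hσa0 : σ a ≠ 0) (hα : α = a / σ a) (hϖσ : ϖ - σ ϖ ≠ 0) (hP0 : ϖ * σ ϖ ≠ 0)
    (he : e * ((ϖ - σ ϖ) * ((ϖ * σ ϖ) ^ ((d - d % 2) / 2))⁻¹) = (α - 1) * c) :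
    e = a₁ * c * (ϖ * σ ϖ) ^ ((d - d % 2) / 2) / (a * σ a) * a := by
  have hσa : σ a = a₀ + a₁ * σ ϖ := by rw [ha, map_add, map_mul, ha₀, ha₁]
  have hPk : (ϖ * σ ϖ) ^ ((d - d % 2) / 2) ≠ 0 := pow_ne_zero _ hP0
  -- `α − 1 = a₁(ϖ − σϖ)∕σa`
  have hα1 : α - 1 = a₁ * (ϖ - σ ϖ) / σ a := by
    rw [hα, div_sub_one hσa0, hσa, ha]; ring
  rw [hα1] at he
  -- clear denominators
  have htp0 : (ϖ - σ ϖ) * ((ϖ * σ ϖ) ^ ((d - d % 2) / 2))⁻¹ ≠ 0 := mul_ne_zero hϖσ (inv_ne_zero hPk)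
  apply mul_right_cancel₀ htp0
  rw [he]
  field_simp

/-- **`σF₀ = F₀`** (`a₀, a₁, c` σ-fixed, `σ` an involution). [cite: Serre1979, Ch. X §1] -/
theorem map_F₀ {σ : K →+* K} (hσσ : ∀ x, σ (σ x) = x) {ϖ a a₁ c : K} {k : ℕ} (ha₁ : σ a₁ = a₁) (hc : σ c = c) :
    σ (a₁ * c * (ϖ * σ ϖ) ^ k / (a * σ a)) = a₁ * c * (ϖ * σ ϖ) ^ k / (a * σ a) := by
  rw [map_div₀, map_mul, map_mul, map_pow, map_mul, map_mul, hσσ, ha₁, hc, hσσ, mul_comm (σ ϖ) ϖ, mul_comm (σ a) a]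

/-! ## §2  The sharp σ-fixed representative `e′ = F₀·a₀` -/

/-- **`e − F₀·a₀ = F₀·a₁·ϖ`** when `e = F₀·a`, `a = a₀ + a₁ϖ`. [cite: Serre1979, Ch. V §3 Cor. 3] -/
theorem sub_sharpRep {F₀ a a₀ a₁ ϖ e : K} (ha : a = a₀ + a₁ * ϖ) (he : e = F₀ * a) : e - F₀ * a₀ = F₀ * a₁ * ϖ := by
  rw [he, ha]; ring

/-- **`F₀·a₀` IS σ-FIXED** (`σF₀ = F₀`, `σa₀ = a₀`). [cite: Serre1979, Ch. V §3 Cor. 3] -/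
theorem map_sharpRep {σ : K →+* K} {F₀ a₀ : K} (hF : σ F₀ = F₀) (ha₀ : σ a₀ = a₀) : σ (F₀ * a₀) = F₀ * a₀ := by
  rw [map_mul, hF, ha₀]

/-! ## §3  The label under the sharp window -/

variable [Valued K ℤᵐ⁰]

/-- **THE LABEL OF `e • X₊` AS THE NORM CLASS OF `F₀·a₀`, UNDER THE SHARP WINDOW.**  Over a complete sheet datum `IsRamifiedQuadraticDatum σ ϖ d t` (`m* = d % 2 + 2d − 1`), with
`e = F₀·a`, `a = a₀ + a₁ϖ`, `σF₀ = F₀`, `σa₀ = a₀`, `|F₀·a₀| = 1`, and the window `|(ϖ^{m*})⁻¹·(F₀·a₁·ϖ·t₊)| ≤ 1`: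
`LabelPlus σ ϖ d m* (e • xPlus σ ϖ d) ↔ ∃ z, z·σz = F₀·a₀`.  With §1 (`F₀ = a₁·c·(ϖσϖ)^{⌊d∕2⌋}∕N(a)`, `c = N(f b i)⁻¹·N(s⋆)`) this is the label of the elliptic frame element `γ_b` at a
one-slot-dominant vertex; the window is `v_E(a₁ϖ) ≥ 2d − 1` on the unit layer, i.e. `v(α − 1) ≥ 3d − 2`. [cite: Serre1979, Ch. V §3 Cor. 3] [cite: Rogawski1990, §4.9 Prop. 4.9.1 (b) p. 55]
[cite: LanglandsShelstad1987, §3] -/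
theorem labelPlus_smul_xPlus_iff_exists_norm_sharpRep [IsAdicComplete 𝓂[K] 𝒪[K]] {σ : K →+* K} {ϖ : K} {d t : ℕ} (hD : IsRamifiedQuadraticDatum σ ϖ d t)
    {F₀ a a₀ a₁ e : K} (ha : a = a₀ + a₁ * ϖ) (he : e = F₀ * a) (hF : σ F₀ = F₀) (ha₀ : σ a₀ = a₀) (he'1 : Valued.v (F₀ * a₀) = 1)
    (hwin : Valued.v ((ϖ ^ (d % 2 + 2 * d - 1))⁻¹ * (F₀ * a₁ * ϖ * ((ϖ - σ ϖ) * ((ϖ * σ ϖ) ^ ((d - d % 2) / 2))⁻¹))) ≤ 1) :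
    LabelPlus σ ϖ d (d % 2 + 2 * d - 1) (e • xPlus σ ϖ d) ↔ ∃ z : K, z * σ z = F₀ * a₀ := by
  refine labelPlus_smul_xPlus_iff_exists_norm_of_congr hD (map_sharpRep hF ha₀) he'1 ?_
  rw [sub_sharpRep ha he]
  exact hwin

/-- **THE UNIT LAYER**: if `|e| = 1`, `|a| = 1` and `|a₁ϖ| < 1` (so `|a₀| = |a|`), then `|F₀·a₀| = 1` and the window reads `|a₁ϖ|·|t₊| ≤ |ϖ^{m*}|` — the SHARP threshold
`v_E(a₁ϖ) ≥ m* − ℓ₀ = 2d − 1` («`v(α − 1) ≥ 3d − 2`» in the PRESCOPE note). [cite: Serre1979, Ch. V §3 Cor. 3] -/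
theorem v_sharpRep_eq_one {F₀ a a₀ a₁ ϖ e : K} (ha : a = a₀ + a₁ * ϖ) (he : e = F₀ * a)
    (he1 : Valued.v e = 1) (ha1 : Valued.v a = 1) (hsmall : Valued.v (a₁ * ϖ) < 1) :
    Valued.v (F₀ * a₀) = 1 ∧ Valued.v (e - F₀ * a₀) = Valued.v (a₁ * ϖ) := by
  have ha₀v : Valued.v a₀ = 1 := by
    have h : a₀ = a - a₁ * ϖ := by rw [ha]; ring
    rw [h, Valuation.map_sub_eq_of_lt_left _ (by rw [ha1]; exact hsmall), ha1]
  have hF₀ : Valued.v F₀ = 1 := by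
    have h := he1; rw [he, map_mul, ha1, mul_one] at h; exact h
  refine ⟨by rw [map_mul, hF₀, ha₀v, mul_one], ?_⟩
  rw [sub_sharpRep ha he, mul_assoc, map_mul, hF₀, one_mul]

end Summit.HodgeConjecture.HodgeConjecture.Cruxes.H413.F0P3cDyRamOneSlotScalarSharpRep

end
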